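import Summits.QuantumFields.BalabanUV.T4Continuum.Support.ShellMeasureWilsonGradientTail
import Literature.MathematicalPhysics.QuantumFieldTheory.ConstructiveQFTWave0
import Literature.MathematicalPhysics.QuantumFieldTheory.Balaban1983to89.B7Prop2SpecialUnitary
import Literature.Barriers.QuantumFields.UnitaryHaarSmallBall

/-!
# `T4Continuum.ShellMeasureWilsonGradientTailSUN` — row S63 (b): the (P4) ONE-GRID FACE AT THE MATRIX ∕ `SU(N)` TYPING —
# `prop4Hyp_wilson_suN`: END-II's `hW`-SHAPE `Prop4Hyp (tail₂ (locGrad 𝒲)) C₄ a₃` for the one-grid Wilson-type action of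
# the discrete torus `(ℤ∕Lℤ)ᵈ` with `N × N` matrix values, `SU(N)`-valued background, EVERY NUMBER EXPLICIT:
# `C₄ = 32·(2(d−1))·N·(1 + e⁴)`, `a₃ = 1∕2`
(cell `pub-balaban`, sub-cell `t4`, spine estimate NE7c (node U5b); NE7c ROUND-2 crew `t4-ne7c-formalise-*`, seat
`b2b-balaban-t4-ne7c-formalise-leaf-09` gen 10; owner table `t4/b2b-balaban-t4-ne7c-p1/LEAVES-NE7c-P1.md` v2.7 row **S63**
letter (b) (claim journal l.14940; letter (a), the `η`-scaled display, is leaf-01-g5's); ADDITIVE — imports the owner's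
S62 f2 `ShellMeasureWilsonGradientTail` (p220909), the torus lattice of `ConstructiveQFTWave0` (`Site`∕`Edge`∕`Plaquette`∕
`plaquetteHolonomy` on `(ℤ∕Lℤ)ᵈ`) b07's `B7Prop2SpecialUnitary` (`specialUnitaryUnits`, unit bounds) and the tree's entry bound `Literature.Barriers.QuantumFields.norm_entry_le_l2_opNorm` (`UnitaryHaarSmallBall`) ONLY; [folklore];
3 data `def`s (`torusBd`, `cand`, `trCLM`), 0 `def … : Prop`, 0 cite, 0 sorry)

HONEST FRAMING.  Finite four-torus programme, rung (B)+1 only — NOT infinite volume, NOT a mass gap, NOT the Clay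
problem, NOT summit progress; (B), `BetaPertHyp`, (B^μ) are not consumed.  NE7c (`T4IndicatorShell.ShellWeightBound`)
is NOT PRINTED and NOT PROVED; «NE7c ⇐ the named binders».  THIS FILE is the `j = 0` KERNEL FACE of ONE W-a binder's
PLAQUETTE PART (WALL §2 (a) item (P4), [Balaban1985Variational] Prop. 4 (97)–(98) TYPE) at the cell's certified matrix
typing — exactly as S62 says for the abstract algebra: the MULTI-SCALE gain of (97) on `Ω_j`, `j ≥ 1` (row S65), the
`HD`-terms of (80) (row S66), the `η`-scaled display (row S63 (a)) and the [dict] identification with END-II's `W𝒱 V`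
(node O) are NOT here; no estimate of Bałaban's at a live level is discharged; nothing printed is asserted.  HONEST
DEPENDENCY (cell): continuum YM on T⁴ ⇐ BetaPertH ∧ nine spine estimates (0/9 proved); BetaPertH ⇐ (D1) ∧ (D4) ∧ CAP+tail;
G-an2-4 gates asym, D1 and NE2/3/4.

THE TYPING (said, as the row asks).  `𝔸 := Matrix (Fin N) (Fin N) ℂ`, `N ≠ 0`, with the L²-OPERATOR (C⋆) norm of the scope
`Matrix.Norms.L2Operator` — the instance of `ShellMeasureWilsonBlock.matrixTrace`, `ShellMeasureWilsonRealizedSUN`, S52's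
`_matrix` and S59 f2 (`NormedRing`, `NormedAlgebra ℂ`, `CompleteSpace`, `NormOneClass` by instance resolution).  The
background `U₀ : Edge d L → 𝔸ˣ` is `SU(N)`-valued in b07's sense (`B7Prop2SpecialUnitary.specialUnitaryUnits (Fin N)`),
whence `‖U₀ e‖, ‖(U₀ e)⁻¹‖ ≤ 1` (`specialUnitaryUnits_le_U1`).  The «trace» is the COMPLEX trace `τ := tr` as a continuous
`ℂ`-linear functional (`trCLM`), with `‖tr‖ ≤ N` PROVED (`|tr X| ≤ Σ_i |X_ii| ≤ N‖X‖_op`); B11's `1 − Re tr` is realised, as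
in S62 f2, by pairing a boundary with its reverse — both are words of the family, nothing is lost.  The plaquettes are
ALL plaquettes `(x, i < j)` of the torus `(ℤ∕Lℤ)ᵈ` with the oriented boundary `(x,i)⁺(x+eᵢ,j)⁺(x+eⱼ,i)⁻(x,j)⁻` (`torusBd`;
`plaqWord_torusBd`: S62 f2's plaquette word IS `ConstructiveQFTWave0.plaquetteHolonomy` of the perturbed configuration
`e^{iA}U₀`), and the incidence `#st(b) ≤ 2(d−1)` is PROVED (`card_filter_torusBd_le`).

## What is proved (all [folklore])
* §1 `torusBd`, `mem_bonds_torusBd`, `plaqWord_torusBd`, **`card_filter_torusBd_le`** (`#st(b) ≤ 2(d−1)` on `(ℤ∕Lℤ)ᵈ`).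
* §2 `trCLM`, `norm_trace_le` (entries by `norm_entry_le_l2_opNorm`), **`norm_trCLM_le`** (`‖tr‖ ≤ N`), `unit_bounds_of_specialUnitary`,
  `prop4Hyp_mono`.
* §3 **`prop4Hyp_wilson_suN_radius`** (every `R > 0`: `C₄ = 32·(2(d−1))·‖tr‖(1 + e^{4R})∕R³`, `a₃ = R∕2`) and
  **`prop4Hyp_wilson_suN`**: `Prop4Hyp (tail₂ (locGrad 𝒲)) (32·(2(d−1))·N·(1 + e⁴)) (1∕2)` for
  `𝒲 = Σ_{p} tr(1 − (e^{iA}U₀)(∂p))` over ALL torus plaquettes — uniform in the `SU(N)`-valued background and in `L`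
  (the volume); `example`: the flat background `U₀ ≡ 1` qualifies (non-vacuity).
-/

noncomputable section

open scoped Matrix.Norms.L2Operator
open Metric

namespace Summit.QuantumFields.BalabanUV.T4Continuum.ShellMeasureWilsonGradientTailSUN

open Literature.MathematicalPhysics.QuantumFieldTheory (Site Edge Plaquette Site.shift plaquetteHolonomy)
open Literature.MathematicalPhysics.QuantumFieldTheory.Balaban1983to89.B7Prop1Explicit (U1 mem_U1)
open Literature.MathematicalPhysics.QuantumFieldTheory.Balaban1983to89.B7Prop2SpecialUnitary (specialUnitaryUnits
  specialUnitaryUnits_le_U1)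
open Literature.MathematicalPhysics.QuantumFieldTheory.Balaban1983to89.B11Prop6Scheme (Prop4Hyp)
open Literature.MathematicalPhysics.QuantumFieldTheory.Balaban1983to89.B12AverageCorridor267 (expU)
open ShellMeasureLocalGradientTail (tail₂ locGrad)
open ShellMeasureWilsonGradientTail (letter plaqWord plaqFun bonds wilsonV prop4Hyp_wilsonV prop4Hyp_wilsonV_one)
open Literature.Barriers.QuantumFields (norm_entry_le_l2_opNorm)

variable {d L : ℕ}

/-! ## §1 The plaquette family of the discrete torus `(ℤ∕Lℤ)ᵈ` and its incidence number -/

/-- The oriented four-letter boundary of the torus plaquette `p = (x, i < j)`: `(x,i)⁺ (x+eᵢ,j)⁺ (x+eⱼ,i)⁻ (x,j)⁻` — the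
letters of `ConstructiveQFTWave0.plaquetteHolonomy U x i j`, in S62 f2's format `Fin 4 → Edge × Bool`. [folklore] -/
def torusBd (p : Plaquette d L) : Fin 4 → Edge d L × Bool :=
  ![((p.1, p.2.1.1), true), ((p.1.shift p.2.1.1, p.2.1.2), true), ((p.1.shift p.2.1.2, p.2.1.1), false),
    ((p.1, p.2.1.2), false)]

/-- The bonds of a torus plaquette boundary are its four sides. [folklore] -/
theorem mem_bonds_torusBd {p : Plaquette d L} {e : Edge d L} (h : e ∈ bonds (torusBd p)) :
    e = (p.1, p.2.1.1) ∨ e = (p.1.shift p.2.1.1, p.2.1.2) ∨ e = (p.1.shift p.2.1.2, p.2.1.1) ∨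
      e = (p.1, p.2.1.2) := by
  rcases Finset.mem_image.1 h with ⟨i, -, rfl⟩
  fin_cases i <;> simp [torusBd]

/-- **S62 f2's PLAQUETTE WORD ALONG `torusBd p` IS THE TORUS PLAQUETTE HOLONOMY of the perturbed configuration
`e^{iA}U₀`** (`ConstructiveQFTWave0.plaquetteHolonomy`, values in the group `𝔸ˣ`). [folklore] -/
theorem plaqWord_torusBd {𝔸 : Type*} [NormedRing 𝔸] [NormedAlgebra ℂ 𝔸] [CompleteSpace 𝔸] (U : Edge d L → 𝔸ˣ)
    (A : Edge d L → 𝔸) (p : Plaquette d L) :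
    plaqWord U (torusBd p) A =
      plaquetteHolonomy (fun e : Edge d L => expU (Complex.I • A e) * U e) p.1 p.2.1.1 p.2.1.2 := by
  simp [plaqWord, torusBd, letter, plaquetteHolonomy, List.ofFn_succ, mul_assoc]

/-- the (at most two) candidate plaquettes through the bond `e = (y, κ)` in the coordinate plane `{κ, ν}`: based at `y`
or at `y − e_ν`. [folklore] -/
def cand (e : Edge d L) (ν : Fin d) : Finset (Plaquette d L) :=
  ((Finset.univ : Finset {q : Fin d × Fin d // q.1 < q.2}).filter
      (fun q => q.1 = (e.2, ν) ∨ q.1 = (ν, e.2))).biUnion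
    fun q => {(e.1, q), (e.1 - Pi.single ν 1, q)}

/-- at most one ORIENTED plane through two coordinate directions. [folklore] -/
theorem card_planeFilter_le_one (κ ν : Fin d) :
    (((Finset.univ : Finset {q : Fin d × Fin d // q.1 < q.2}).filter
      (fun q => q.1 = (κ, ν) ∨ q.1 = (ν, κ))).card) ≤ 1 := by
  refine Finset.card_le_one.2 fun q hq q' hq' => ?_
  simp only [Finset.mem_filter, Finset.mem_univ, true_and] at hq hq'
  have hlt := q.2
  have hlt' := q'.2
  apply Subtype.ext
  rcases hq with h | h <;> rcases hq' with h' | h' <;> rw [h, h'] <;> rw [h] at hlt <;> rw [h'] at hlt' <;>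
    simp only at hlt hlt' <;> omega

/-- hence at most two candidates per plane. [folklore] -/
theorem card_cand_le (e : Edge d L) (ν : Fin d) : (cand e ν).card ≤ 2 := by
  unfold cand
  refine (Finset.card_biUnion_le).trans ?_
  calc ∑ q ∈ (Finset.univ.filter fun q : {q : Fin d × Fin d // q.1 < q.2} => q.1 = (e.2, ν) ∨ q.1 = (ν, e.2)),
        ({(e.1, q), (e.1 - Pi.single ν 1, q)} : Finset (Plaquette d L)).card
      ≤ ∑ _q ∈ (Finset.univ.filter fun q : {q : Fin d × Fin d // q.1 < q.2} => q.1 = (e.2, ν) ∨ q.1 = (ν, e.2)), 2 :=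
        Finset.sum_le_sum fun q _ => Finset.card_le_two
    _ ≤ 1 * 2 := by
        rw [Finset.sum_const, smul_eq_mul]
        exact Nat.mul_le_mul_right 2 (card_planeFilter_le_one e.2 ν)
    _ = 2 := by norm_num

/-- every plaquette through `e` is a candidate in some plane `ν ≠ κ` (the four cases of `mem_bonds_torusBd`). [folklore] -/
theorem mem_cand_of_mem {e : Edge d L} {p : Plaquette d L} (h : e ∈ bonds (torusBd p)) :
    ∃ ν, ν ≠ e.2 ∧ p ∈ cand e ν := by
  obtain ⟨x, ⟨⟨i, j⟩, hij⟩⟩ := p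
  have hne : i ≠ j := ne_of_lt hij
  simp only [cand, Finset.mem_biUnion, Finset.mem_filter, Finset.mem_univ, true_and, Finset.mem_insert,
    Finset.mem_singleton]
  have hsh : ∀ μ : Fin d, (x.shift μ) - Pi.single μ 1 = x := fun μ => by
    rw [Site.shift, add_sub_cancel_right]
  rcases mem_bonds_torusBd h with he | he | he | he <;> rw [he]
  · exact ⟨j, hne.symm, ⟨(i, j), hij⟩, Or.inl rfl, Or.inl rfl⟩
  · exact ⟨i, hne, ⟨(i, j), hij⟩, Or.inr rfl, Or.inr (by rw [hsh])⟩
  · exact ⟨j, hne.symm, ⟨(i, j), hij⟩, Or.inl rfl, Or.inr (by rw [hsh])⟩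
  · exact ⟨i, hne, ⟨(i, j), hij⟩, Or.inr rfl, Or.inl rfl⟩

/-- **INCIDENCE ON THE TORUS: at most `2(d − 1)` plaquettes through a bond** (`#st(b) ≤ 2(d−1)`, S62's `m`): the
plaquettes whose boundary contains `e = (y, κ)` lie among `(y, {κ,ν})`, `(y − e_ν, {κ,ν})`, `ν ≠ κ`. [folklore] -/
theorem card_filter_torusBd_le [NeZero L] (e : Edge d L) :
    ((Finset.univ : Finset (Plaquette d L)).filter (fun p => e ∈ bonds (torusBd p))).card ≤ 2 * (d - 1) := by
  classical
  have hsub : ((Finset.univ : Finset (Plaquette d L)).filter (fun p => e ∈ bonds (torusBd p)))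
      ⊆ (Finset.univ.erase e.2).biUnion (cand e) := by
    intro p hp
    rw [Finset.mem_filter] at hp
    obtain ⟨ν, hν, hpν⟩ := mem_cand_of_mem hp.2
    exact Finset.mem_biUnion.2 ⟨ν, Finset.mem_erase.2 ⟨hν, Finset.mem_univ ν⟩, hpν⟩
  refine (Finset.card_le_card hsub).trans ((Finset.card_biUnion_le).trans ?_)
  calc ∑ ν ∈ Finset.univ.erase e.2, (cand e ν).card ≤ ∑ _ν ∈ Finset.univ.erase e.2, 2 :=
        Finset.sum_le_sum fun ν _ => card_cand_le e ν
    _ = 2 * (d - 1) := by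
        rw [Finset.sum_const, smul_eq_mul, Finset.card_erase_of_mem (Finset.mem_univ _), Finset.card_univ,
          Fintype.card_fin, mul_comm]

/-! ## §2 The matrix typing: the trace functional and the `SU(N)` unit bounds -/

section MatrixData

variable {N : ℕ}

/-- The complex trace on `M_N(ℂ)` as a continuous `ℂ`-linear functional (the `τ` of S62 f2). [folklore] -/
def trCLM (N : ℕ) : Matrix (Fin N) (Fin N) ℂ →L[ℂ] ℂ :=
  LinearMap.toContinuousLinearMap (Matrix.traceLinearMap (Fin N) ℂ ℂ)

/-- unfolding. [folklore] -/
@[simp] theorem trCLM_apply (X : Matrix (Fin N) (Fin N) ℂ) : trCLM N X = Matrix.trace X := rfl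

/-- `|tr X| ≤ N·‖X‖` in the operator norm. [folklore] -/
theorem norm_trace_le (X : Matrix (Fin N) (Fin N) ℂ) : ‖Matrix.trace X‖ ≤ N * ‖X‖ := by
  calc ‖Matrix.trace X‖ = ‖∑ i, X i i‖ := by rw [Matrix.trace]; rfl
    _ ≤ ∑ i, ‖X i i‖ := norm_sum_le _ _
    _ ≤ ∑ _i : Fin N, ‖X‖ := Finset.sum_le_sum fun i _ => norm_entry_le_l2_opNorm X i i
    _ = N * ‖X‖ := by simp

/-- **`‖tr‖ ≤ N`** as a continuous linear functional on `(M_N(ℂ), ‖·‖_op)`. [folklore] -/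
theorem norm_trCLM_le : ‖trCLM N‖ ≤ N :=
  ContinuousLinearMap.opNorm_le_bound _ (Nat.cast_nonneg N) fun X => by
    rw [trCLM_apply]; exact norm_trace_le X

/-- an `SU(N)`-valued bond configuration is unit-bounded with unit-bounded inverses (b07's
`specialUnitaryUnits_le_U1`: `SU(N) ⊂ {|u| ≤ 1, |u⁻¹| ≤ 1}` in the operator norm). [folklore] -/
theorem unit_bounds_of_specialUnitary [NeZero N] {Λ : Type*} {U : Λ → (Matrix (Fin N) (Fin N) ℂ)ˣ}
    (hU : ∀ b, U b ∈ specialUnitaryUnits (Fin N)) :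
    (∀ b, ‖((U b : (Matrix (Fin N) (Fin N) ℂ)ˣ) : Matrix (Fin N) (Fin N) ℂ)‖ ≤ 1) ∧
      ∀ b, ‖(((U b)⁻¹ : (Matrix (Fin N) (Fin N) ℂ)ˣ) : Matrix (Fin N) (Fin N) ℂ)‖ ≤ 1 :=
  ⟨fun b => (mem_U1.1 (specialUnitaryUnits_le_U1 (hU b))).1, fun b => (mem_U1.1 (specialUnitaryUnits_le_U1 (hU b))).2⟩

end MatrixData

/-- `Prop4Hyp` is monotone in the quadratic constant. [folklore] -/
theorem prop4Hyp_mono {𝒴 𝒵 : Type*} [NormedAddCommGroup 𝒴] [NormedSpace ℂ 𝒴] [NormedAddCommGroup 𝒵] [NormedSpace ℂ 𝒵]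
    {W : 𝒴 → 𝒵} {C₄ C₄' a₃ : ℝ} (h : Prop4Hyp W C₄ a₃) (hC : C₄ ≤ C₄') : Prop4Hyp W C₄' a₃ where
  quad Y hY := (h.quad Y hY).trans (mul_le_mul_of_nonneg_right hC (sq_nonneg _))
  differentiableOn := h.differentiableOn

/-! ## §3 The (P4) one-grid face for the torus Wilson action with `SU(N)`-valued background -/

section SUN

variable {N : ℕ} [NeZero N] [NeZero L]

/-- **(P4) ONE-GRID FACE, MATRIX ∕ `SU(N)` TYPING, EVERY RADIUS**: for an `SU(N)`-valued background `U₀` on the torus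
`(ℤ∕Lℤ)ᵈ` and every `R > 0`, the order-≥3 part of the one-grid action `𝒲(A) = Σ_p tr(1 − (e^{iA}U₀)(∂p))` (ALL torus
plaquettes) has `Prop4Hyp (tail₂ (locGrad 𝒲)) (32·(2(d−1))·‖tr‖(1 + e^{4R})∕R³) (R∕2)` — S62 f2's `prop4Hyp_wilsonV` with the
incidence `2(d−1)` (§1) and the unit bounds of `SU(N)` (§2) supplied. [folklore] -/
theorem prop4Hyp_wilson_suN_radius (U₀ : Edge d L → (Matrix (Fin N) (Fin N) ℂ)ˣ)
    (hU₀ : ∀ e, U₀ e ∈ specialUnitaryUnits (Fin N)) {R : ℝ} (hR : 0 < R) :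
    Prop4Hyp (tail₂ (locGrad (wilsonV (Finset.univ : Finset (Plaquette d L)) torusBd (trCLM N) U₀)))
      (32 * ((2 * (d - 1) : ℕ) : ℝ) * (‖trCLM N‖ * (1 + Real.exp (4 * R))) / R ^ 3) (R / 2) :=
  prop4Hyp_wilsonV (Finset.univ : Finset (Plaquette d L)) torusBd (trCLM N) U₀
    (unit_bounds_of_specialUnitary hU₀).1 (unit_bounds_of_specialUnitary hU₀).2 card_filter_torusBd_le hR

/-- **(P4) ONE-GRID FACE, MATRIX ∕ `SU(N)` TYPING, EVERY NUMBER EXPLICIT**: at `R = 1`, with `‖tr‖ ≤ N`,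
`Prop4Hyp (tail₂ (locGrad 𝒲)) (32·(2(d−1))·N·(1 + e⁴)) (1∕2)` for the torus Wilson action about ANY `SU(N)`-valued
background — `C₄ = 32·(2(d−1))·N·(1 + e⁴)` depends on `d` and `N` ONLY (not on the background, not on the volume `Lᵈ`),
`a₃ = 1∕2`; [Balaban1985Variational] (97) «the constants a₃, C₄ depend on d and L only» at ONE grid for the plaquette
part (the multi-scale gain on `Ω_j`, the `HD`-terms and the `η`-scaling are rows S65∕S66∕S63 (a)). [folklore] -/
theorem prop4Hyp_wilson_suN (U₀ : Edge d L → (Matrix (Fin N) (Fin N) ℂ)ˣ)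
    (hU₀ : ∀ e, U₀ e ∈ specialUnitaryUnits (Fin N)) :
    Prop4Hyp (tail₂ (locGrad (wilsonV (Finset.univ : Finset (Plaquette d L)) torusBd (trCLM N) U₀)))
      (32 * ((2 * (d - 1) : ℕ) : ℝ) * ((N : ℝ) * (1 + Real.exp 4))) (1 / 2) := by
  have h := prop4Hyp_wilsonV_one (Finset.univ : Finset (Plaquette d L)) torusBd (trCLM N) U₀
    (unit_bounds_of_specialUnitary hU₀).1 (unit_bounds_of_specialUnitary hU₀).2 card_filter_torusBd_le
  refine prop4Hyp_mono h ?_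
  have h1 : 0 ≤ 1 + Real.exp 4 := by positivity
  have h2 : (0 : ℝ) ≤ 32 * ((2 * (d - 1) : ℕ) : ℝ) := by positivity
  exact mul_le_mul_of_nonneg_left (mul_le_mul_of_nonneg_right norm_trCLM_le h1) h2

/-- NON-VACUITY: the flat background `U₀ ≡ 1` is `SU(N)`-valued, so `prop4Hyp_wilson_suN` FIRES at it (every `d`, `L`,
`N`). [folklore] -/
example : Prop4Hyp (tail₂ (locGrad (wilsonV (Finset.univ : Finset (Plaquette d L)) torusBd (trCLM N)
      (1 : Edge d L → (Matrix (Fin N) (Fin N) ℂ)ˣ))))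
    (32 * ((2 * (d - 1) : ℕ) : ℝ) * ((N : ℝ) * (1 + Real.exp 4))) (1 / 2) :=
  prop4Hyp_wilson_suN 1 fun _ => Subgroup.one_mem _

end SUN

end Summit.QuantumFields.BalabanUV.T4Continuum.ShellMeasureWilsonGradientTailSUN

end
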